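/-
Copyright: the b2b-balaban T⁴-continuum CRUX team, row NE7b leaf lineage `t4-ne7b-formalise-leaf-06` (gen 154). Project licence.
-/
import Mathlib.Analysis.SpecialFunctions.Exp
import Mathlib.Analysis.Complex.Exponential
import Mathlib.Topology.Algebra.InfiniteSum.NatInt
import Literature.Analysis.FunctionSpaces.TorusScalarFourierSeries

/-!
# DECAY GIVES THE MOMENTS ON `ℤ^d`: a kernel `k` on `ι → ℤ` (`ι` finite) with `|k x| ≤ M·e^{−κ‖x‖₁}`, `κ > 0`, has EVERY
# isotropic moment `Σ_x |k x|·‖x‖₁ⁿ`, every coordinate moment `Σ_x |k x|·|x_j|ⁿ` and every DIRECTIONAL moment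
# `Σ_x |k x|·|Σ_j x_j e_j|ⁿ` summable — `…LatticeKernelMomentsSummable`'s letter `hmom` for `d`-dimensional rays
# (row NE7b, node U5c; [folklore]: `sⁿe^{−cs} ≤ n!∕cⁿ` and `e^{−c‖x‖₁} = Π_j e^{−c|x_j|}` is summable coordinatewise)

Cell `pub-balaban`, sub-cell `t4`, spine estimate NE7b (`T4WeightBudget.RelWeightBound`; the cell's OWN estimate — NOT PRINTED in
[Bałaban 1983–89], NOT PROVED).  Crux-route work under `Spine/NE7b/` by a row leaf on the convexity road under FREEZE (0)'s crux-prover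
clause; NOTHING of Bałaban's is named or asserted; no `T4Continuum/Support` leaf typed; no `def`; zero `sorry`.  Imports: Mathlib and
`Literature.Analysis.FunctionSpaces.TorusScalarFourierSeries` (for `Torus.summable_pi_prod_weight` — products of a summable non-negative
weight over the coordinates are summable on `ι → ℤ` — BY NAME; nothing else of that file is used).

WHY.  `…LatticeKernelMomentsSummable` (LKMS, p379372, this lineage) types the `Σ'` symbol `Φ(t) = Σ'_i k i·cos(ω i·t)` under the letter
`hmom : ∀ n ≤ N, Summable (|k ·|·|ω ·|ⁿ)` and discharges `hmom` from an exponential decay ONLY ON `ℤ` (§4 there); its NOT-HERE names the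
`d`-dimensional rays «`ι = (Fin d → ℤ)`, `ω x = Σ_j x_j e_j` … the directional moments `Σ' |k x|·|⟨x,e⟩|ⁿ` are the consumer's, bounded by
isotropic ones with `|⟨x,e⟩| ≤ ‖x‖₁‖e‖_∞`».  The inherited kernels the road reads BY SHAPE live on a `d = 4` lattice with an exponential
(tree) decay, so the consumer's `ι` is `Fin 4 → ℤ`, not `ℤ`.  THIS FILE discharges `hmom` there, for EVERY `n`, from the decay letter alone:
`‖x‖₁ⁿe^{−κ‖x‖₁} ≤ n!(2∕κ)ⁿ·e^{−(κ∕2)‖x‖₁}` and `e^{−(κ∕2)‖x‖₁} = Π_j e^{−(κ∕2)|x_j|}` is summable on `ι → ℤ` because `e^{−(κ∕2)|m|}` is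
summable on `ℤ` (the product lemma is the Literature's `Torus.summable_pi_prod_weight`).

WHAT IS PROVED ([folklore]; throughout `ι` is a `Fintype`, `x : ι → ℤ`, and `‖x‖₁` is written inline as `Σ_j |(x j : ℝ)|`):
* §1 ONE-DIMENSIONAL WEIGHTS: `summable_exp_neg_mul_abs_int` (`Σ_{m∈ℤ} e^{−c|m|} < ∞` for `c > 0`), **`pow_mul_exp_neg_mul_le`**
  (`sⁿ·e^{−cs} ≤ n!∕cⁿ` for `s ≥ 0`, `c > 0` — Mathlib's `Real.pow_div_factorial_le_exp` rescaled).
* §2 THE `ℓ¹` WEIGHT ON `ι → ℤ`: `exp_neg_mul_norm1_eq_prod` (`e^{−c‖x‖₁} = Π_j e^{−c|x_j|}`), **`summable_exp_neg_mul_norm1`**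
  (`Σ_x e^{−c‖x‖₁} < ∞`), **`summable_norm1_pow_mul_exp_neg`** (`Σ_x ‖x‖₁ⁿ·e^{−κ‖x‖₁} < ∞` for every `n`, majorant `n!(2∕κ)ⁿ·e^{−(κ∕2)‖x‖₁}`).
* §3 DECAY GIVES THE MOMENTS (`hdecay : ∀ x, |k x| ≤ M·e^{−κ‖x‖₁}`, `κ > 0`): **`summable_moment_of_decay_pi`** (isotropic:
  `Summable (|k x|·‖x‖₁ⁿ)` for EVERY `n`), `summable_abs_of_decay_pi` (`n = 0`: `k ∈ ℓ¹`), `summable_coord_moment_of_decay_pi`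
  (`Summable (|k x|·|x_j|ⁿ)`), `abs_sum_mul_le` (`|Σ_j x_j e_j| ≤ E·‖x‖₁` when `|e_j| ≤ E`), **`summable_directional_moment_of_decay_pi`**
  (`Summable (|k x|·|Σ_j x_j e_j|ⁿ)` for EVERY `n` and every direction `e`).
* §4 THE END IN LKMS's CURRENCY: **`moments_of_decay_pi`** — under the decay letter, for `ω x = Σ_j (x j)·e_j` and ANY `N`:
  `∀ n ≤ N, Summable (fun x => |k x| * |ω x| ^ n)` — VERBATIM the hypothesis `hmom` of LKMS §2–§3 (`contDiff_symbol`,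
  `abs_iteratedDeriv_symbol_le`, `iteratedDeriv_two_symbol_zero`, `abs_symbol_sub_marginal_le`) on the index `ι → ℤ`.
* §5 toy (kernel): `ι = Fin 2`, `k x = ½e^{−‖x‖₁}`, `M = κ = 1`: the third isotropic moment and every directional moment are summable.

NOT HERE (honest): explicit VALUES of the moments (only summability is typed; a value bound `Σ_x ‖x‖₁ⁿe^{−κ‖x‖₁} ≤ n!(2∕κ)ⁿ(Σ_m e^{−(κ∕2)|m|})^d`
is one `tsum` comparison away and is not needed by LKMS); other norms (`‖x‖_∞`, Euclidean — equivalent on `Fin d` up to constants, the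
consumer's); tree-decay letters on POLYMERS (`…LocalTermsTreeDecay`, a different object); form-valued kernels; the junction with LKMS BY
IMPORT (olean); WHICH kernels print's inherited terms have and their `(M, κ)` ([Balaban1987RGApproachI] (1.18) BY SHAPE only; (A3) ∕ (A1c),
NC-NE7b-α UNRULED); anything of Bałaban's.  BY-NAME EFFECT ON THE WALL: NONE (a supplier for LKMS's displayed letter).  NE7b NOT
PRINTED ∕ NOT PROVED; spine PROVED 0∕9; rung (B)+1 on a FINITE torus — NOT infinite volume, NOT the mass gap, NOT Clay.  HONEST DEPENDENCY:
continuum YM on T⁴ ⇐ BetaPertH ∧ nine spine estimates (0∕9 proved); BetaPertH ⇐ (D1) ∧ (D4) ∧ CAP+tail; G-an2-4 gates asym, D1 and NE2∕3∕4.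
-/

set_option autoImplicit false

noncomputable section

open Set Filter Topology Real Finset

namespace Summit.QuantumFields.BalabanUV.T4Continuum.NE7b.LatticeKernelDecayMoments

open scoped Nat

/-! ## §1 One-dimensional weights -/

/-- `Σ_{m ∈ ℤ} e^{−c|m|} < ∞` for `c > 0` (both half-lines by Mathlib's `summable_pow_mul_exp_neg_nat_mul 0`). [folklore] -/
theorem summable_exp_neg_mul_abs_int {c : ℝ} (hc : 0 < c) : Summable fun m : ℤ => exp (-c * |(m : ℝ)|) := by
  have h := Real.summable_pow_mul_exp_neg_nat_mul 0 hc
  simp only [pow_zero, one_mul] at h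
  refine Summable.of_nat_of_neg ?_ ?_
  · simpa [Nat.abs_cast] using h
  · simpa [abs_neg, Nat.abs_cast] using h

/-- **`sⁿ·e^{−cs} ≤ n!∕cⁿ`** for `s ≥ 0`, `c > 0` (from `(cs)ⁿ∕n! ≤ e^{cs}`). [folklore] -/
theorem pow_mul_exp_neg_mul_le {c : ℝ} (hc : 0 < c) (n : ℕ) {s : ℝ} (hs : 0 ≤ s) :
    s ^ n * exp (-c * s) ≤ n ! / c ^ n := by
  have hfac : (0 : ℝ) < n ! := Nat.cast_pos.mpr (Nat.factorial_pos n)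
  have h := Real.pow_div_factorial_le_exp (c * s) (mul_nonneg hc.le hs) n
  rw [div_le_iff₀ hfac] at h
  rw [le_div_iff₀ (pow_pos hc n)]
  have hrw : s ^ n * exp (-c * s) * c ^ n = (c * s) ^ n / exp (c * s) := by
    rw [neg_mul, Real.exp_neg, mul_pow, div_eq_mul_inv]
    ring
  rw [hrw, div_le_iff₀ (exp_pos _)]
  linarith

/-! ## §2 The `ℓ¹` weight on `ι → ℤ` -/

section Pi

variable {ι : Type*} [Fintype ι]

/-- `e^{−c‖x‖₁} = Π_j e^{−c|x_j|}`. [folklore] -/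
theorem exp_neg_mul_norm1_eq_prod (c : ℝ) (x : ι → ℤ) :
    exp (-c * ∑ j, |(x j : ℝ)|) = ∏ j, exp (-c * |(x j : ℝ)|) := by
  rw [Finset.mul_sum, Real.exp_sum]

/-- **`Σ_{x ∈ ℤ^ι} e^{−c‖x‖₁} < ∞`** for `c > 0` (coordinatewise product of a summable weight — the Literature's
`Torus.summable_pi_prod_weight` BY NAME). [folklore] -/
theorem summable_exp_neg_mul_norm1 {c : ℝ} (hc : 0 < c) :
    Summable fun x : ι → ℤ => exp (-c * ∑ j, |(x j : ℝ)|) := by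
  have h := Literature.Analysis.FunctionSpaces.Torus.summable_pi_prod_weight (d := ι)
    (summable_exp_neg_mul_abs_int hc) (fun m => (exp_pos _).le)
  refine h.congr fun x => ?_
  exact (exp_neg_mul_norm1_eq_prod c x).symm

/-- **`Σ_{x ∈ ℤ^ι} ‖x‖₁ⁿ·e^{−κ‖x‖₁} < ∞`** for every `n` and `κ > 0` (majorant `n!(2∕κ)ⁿ·e^{−(κ∕2)‖x‖₁}`). [folklore] -/
theorem summable_norm1_pow_mul_exp_neg {κ : ℝ} (hκ : 0 < κ) (n : ℕ) :
    Summable fun x : ι → ℤ => (∑ j, |(x j : ℝ)|) ^ n * exp (-κ * ∑ j, |(x j : ℝ)|) := by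
  have hκ2 : 0 < κ / 2 := by positivity
  have hmaj := (summable_exp_neg_mul_norm1 (ι := ι) hκ2).mul_left (n ! / (κ / 2) ^ n)
  refine Summable.of_nonneg_of_le (fun x => by positivity) (fun x => ?_) hmaj
  set S : ℝ := ∑ j, |(x j : ℝ)| with hS
  have hs : 0 ≤ S := Finset.sum_nonneg fun j _ => abs_nonneg _
  have h1 : S ^ n * exp (-(κ / 2) * S) ≤ n ! / (κ / 2) ^ n := pow_mul_exp_neg_mul_le hκ2 n hs
  have hsplit : exp (-κ * S) = exp (-(κ / 2) * S) * exp (-(κ / 2) * S) := by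
    rw [← Real.exp_add]
    ring_nf
  calc S ^ n * exp (-κ * S) = S ^ n * exp (-(κ / 2) * S) * exp (-(κ / 2) * S) := by rw [hsplit, mul_assoc]
    _ ≤ n ! / (κ / 2) ^ n * exp (-(κ / 2) * S) := mul_le_mul_of_nonneg_right h1 (exp_pos _).le

/-! ## §3 Decay gives the moments -/

/-- **DECAY GIVES THE ISOTROPIC MOMENTS**: `|k x| ≤ M·e^{−κ‖x‖₁}` on `ι → ℤ`, `κ > 0` ⟹ `Σ_x |k x|·‖x‖₁ⁿ < ∞` for EVERY `n`.
[folklore] -/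
theorem summable_moment_of_decay_pi {k : (ι → ℤ) → ℝ} {M κ : ℝ} (hκ : 0 < κ)
    (hdecay : ∀ x : ι → ℤ, |k x| ≤ M * exp (-κ * ∑ j, |(x j : ℝ)|)) (n : ℕ) :
    Summable fun x : ι → ℤ => |k x| * (∑ j, |(x j : ℝ)|) ^ n := by
  have hM : 0 ≤ M := by
    have h := hdecay 0
    simp only [Pi.zero_apply, Int.cast_zero, abs_zero, Finset.sum_const_zero, mul_zero, exp_zero, mul_one] at h
    exact (abs_nonneg _).trans h
  have hmaj := (summable_norm1_pow_mul_exp_neg (ι := ι) hκ n).mul_left M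
  refine Summable.of_nonneg_of_le (fun x => by positivity) (fun x => ?_) hmaj
  calc |k x| * (∑ j, |(x j : ℝ)|) ^ n ≤ M * exp (-κ * ∑ j, |(x j : ℝ)|) * (∑ j, |(x j : ℝ)|) ^ n :=
        mul_le_mul_of_nonneg_right (hdecay x) (by positivity)
    _ = M * ((∑ j, |(x j : ℝ)|) ^ n * exp (-κ * ∑ j, |(x j : ℝ)|)) := by ring

/-- `n = 0`: an exponentially decaying kernel on `ι → ℤ` is absolutely summable. [folklore] -/
theorem summable_abs_of_decay_pi {k : (ι → ℤ) → ℝ} {M κ : ℝ} (hκ : 0 < κ)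
    (hdecay : ∀ x : ι → ℤ, |k x| ≤ M * exp (-κ * ∑ j, |(x j : ℝ)|)) : Summable fun x : ι → ℤ => |k x| := by
  simpa using summable_moment_of_decay_pi hκ hdecay 0

/-- **COORDINATE MOMENTS**: under the decay letter `Σ_x |k x|·|x_{j₀}|ⁿ < ∞` (`|x_{j₀}| ≤ ‖x‖₁`). [folklore] -/
theorem summable_coord_moment_of_decay_pi {k : (ι → ℤ) → ℝ} {M κ : ℝ} (hκ : 0 < κ)
    (hdecay : ∀ x : ι → ℤ, |k x| ≤ M * exp (-κ * ∑ j, |(x j : ℝ)|)) (j₀ : ι) (n : ℕ) :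
    Summable fun x : ι → ℤ => |k x| * |(x j₀ : ℝ)| ^ n := by
  refine Summable.of_nonneg_of_le (fun x => by positivity) (fun x => ?_) (summable_moment_of_decay_pi hκ hdecay n)
  have hle : |(x j₀ : ℝ)| ≤ ∑ j, |(x j : ℝ)| :=
    Finset.single_le_sum (f := fun j => |(x j : ℝ)|) (fun j _ => abs_nonneg _) (Finset.mem_univ j₀)
  exact mul_le_mul_of_nonneg_left (pow_le_pow_left₀ (abs_nonneg _) hle n) (abs_nonneg _)

/-- `|Σ_j x_j e_j| ≤ E·‖x‖₁` when `|e_j| ≤ E` for all `j`. [folklore] -/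
theorem abs_sum_mul_le {e : ι → ℝ} {E : ℝ} (he : ∀ j, |e j| ≤ E) (x : ι → ℤ) :
    |∑ j, (x j : ℝ) * e j| ≤ E * ∑ j, |(x j : ℝ)| := by
  calc |∑ j, (x j : ℝ) * e j| ≤ ∑ j, |(x j : ℝ) * e j| := Finset.abs_sum_le_sum_abs _ _
    _ = ∑ j, |(x j : ℝ)| * |e j| := by simp_rw [abs_mul]
    _ ≤ ∑ j, |(x j : ℝ)| * E := Finset.sum_le_sum fun j _ => mul_le_mul_of_nonneg_left (he j) (abs_nonneg _)
    _ = E * ∑ j, |(x j : ℝ)| := by rw [← Finset.sum_mul, mul_comm]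

/-- **DECAY GIVES THE DIRECTIONAL MOMENTS**: `|k x| ≤ M·e^{−κ‖x‖₁}`, `κ > 0`, `|e_j| ≤ E` ⟹ `Σ_x |k x|·|Σ_j x_j e_j|ⁿ < ∞` for
EVERY `n` (majorant `(max E 0)ⁿ·|k x|·‖x‖₁ⁿ`). [folklore] -/
theorem summable_directional_moment_of_decay_pi {k : (ι → ℤ) → ℝ} {M κ : ℝ} (hκ : 0 < κ)
    (hdecay : ∀ x : ι → ℤ, |k x| ≤ M * exp (-κ * ∑ j, |(x j : ℝ)|)) {e : ι → ℝ} {E : ℝ} (he : ∀ j, |e j| ≤ E)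
    (n : ℕ) : Summable fun x : ι → ℤ => |k x| * |∑ j, (x j : ℝ) * e j| ^ n := by
  have hle : ∀ x : ι → ℤ, |∑ j, (x j : ℝ) * e j| ≤ max E 0 * ∑ j, |(x j : ℝ)| := fun x =>
    (abs_sum_mul_le he x).trans
      (mul_le_mul_of_nonneg_right (le_max_left _ _) (Finset.sum_nonneg fun j _ => abs_nonneg _))
  have hmaj := (summable_moment_of_decay_pi hκ hdecay n).mul_left (max E 0 ^ n)
  refine Summable.of_nonneg_of_le (fun x => by positivity) (fun x => ?_) hmaj
  calc |k x| * |∑ j, (x j : ℝ) * e j| ^ n ≤ |k x| * (max E 0 * ∑ j, |(x j : ℝ)|) ^ n :=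
        mul_le_mul_of_nonneg_left (pow_le_pow_left₀ (abs_nonneg _) (hle x) n) (abs_nonneg _)
    _ = max E 0 ^ n * (|k x| * (∑ j, |(x j : ℝ)|) ^ n) := by rw [mul_pow]; ring

/-! ## §4 The END in `…LatticeKernelMomentsSummable`'s currency -/

/-- **THE LETTER `hmom` ON `ℤ^ι` FROM THE DECAY**: `|k x| ≤ M·e^{−κ‖x‖₁}`, `κ > 0`, a direction `e` with `|e_j| ≤ E`, the
frequencies `ω x = Σ_j (x j)·e_j` ⟹ for ANY `N`: `∀ n ≤ N, Summable (fun x => |k x| * |ω x| ^ n)` — verbatim the hypothesis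
of LKMS §2–§3 on the index `ι → ℤ`. [folklore] -/
theorem moments_of_decay_pi {k : (ι → ℤ) → ℝ} {M κ : ℝ} (hκ : 0 < κ)
    (hdecay : ∀ x : ι → ℤ, |k x| ≤ M * exp (-κ * ∑ j, |(x j : ℝ)|)) {e : ι → ℝ} {E : ℝ} (he : ∀ j, |e j| ≤ E)
    (N : ℕ) : ∀ n ≤ N, Summable fun x : ι → ℤ => |k x| * |(fun y : ι → ℤ => ∑ j, (y j : ℝ) * e j) x| ^ n :=
  fun n _ => summable_directional_moment_of_decay_pi hκ hdecay he n

end Pi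

/-! ## §5 Toy (kernel): `ι = Fin 2`, `k x = ½e^{−‖x‖₁}` -/

/-- Toy: on `Fin 2 → ℤ` the kernel `½e^{−‖x‖₁}` obeys the decay letter with `M = κ = 1`, so its third isotropic moment is
summable. -/
example : Summable fun x : Fin 2 → ℤ =>
    |(1 / 2 : ℝ) * exp (-1 * ∑ j, |(x j : ℝ)|)| * (∑ j, |(x j : ℝ)|) ^ 3 := by
  refine summable_moment_of_decay_pi (M := 1) one_pos (fun x => ?_) 3
  rw [abs_of_nonneg (by positivity)]
  linarith [exp_pos (-1 * ∑ j, |(x j : ℝ)|)]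

/-- Toy: the same kernel has every directional moment along `e = (1, −1)` (`|e_j| ≤ 1`), in LKMS's `hmom` shape with `N = 4`. -/
example : ∀ n ≤ 4, Summable fun x : Fin 2 → ℤ =>
    |(1 / 2 : ℝ) * exp (-1 * ∑ j, |(x j : ℝ)|)| * |(fun y : Fin 2 → ℤ => ∑ j, (y j : ℝ) * ![(1 : ℝ), -1] j) x| ^ n := by
  refine moments_of_decay_pi (M := 1) one_pos (fun x => ?_) (E := 1) (fun j => ?_) 4
  · rw [abs_of_nonneg (by positivity)]
    linarith [exp_pos (-1 * ∑ j, |(x j : ℝ)|)]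
  · fin_cases j <;> simp

end Summit.QuantumFields.BalabanUV.T4Continuum.NE7b.LatticeKernelDecayMoments

end
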